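import Summits.Ventures.PercRepro.PuncturedLYMSuperMain

/-!
# PercRepro — (SP) ON AN ARBITRARY GROUND FINSET: THE TRANSFER THROUGH THE SUBTYPE (p10, gen 31)

The modules PuncturedLYM* state (SP) on the whole type `α` (`punctured`, `levelAbove` live inside `univ`).  For the matroid
bridge on a ground set `E ⊊ univ` we transfer it to `E`: a family `D` of `j`-subsets of `E` is a code in `E` (`IsCodeIn`)
iff its image under `X ↦ X.subtype (· ∈ E)` is a code on the subtype `↥E`; the punctured level, the level above and the
up-shadows correspond bijectively (`subtype` is injective on the subsets of `E` and inverse to `map`), so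
* `puncturedNMP_in_of_subtype` — (SP) for the image code on `↥E` gives the inequality
  `#𝒜 · C(#E, j+1) ≤ #N_E(𝒜) · #P_E` for every `𝒜 ⊆ P_E = C(E, j) ∖ D`, with `N_E(𝒜)` the `(j+1)`-subsets of `E` above `𝒜`;
* **`puncturedNMP_in_of_three_j`** — THEOREM A on `E`: the inequality holds for every code in `E` with `1 ≤ j`,
  `2j + 1 ≤ #E`, `3j ≤ #E + 1`.
Nothing here asserts (SP) in general.
-/

namespace PercRepro.PuncturedLYM

open Finset

variable {α : Type} [DecidableEq α]

/-! ### Codes inside a finset -/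

/-- A code of `j`-subsets of the finset `E`. -/
def IsCodeIn (j : ℕ) (E : Finset α) (D : Finset (Finset α)) : Prop :=
  (∀ B ∈ D, B ⊆ E ∧ B.card = j) ∧ ∀ B ∈ D, ∀ B' ∈ D, B ≠ B' → (B ∩ B').card + 2 ≤ j

/-- The punctured level inside `E`. -/
def puncturedIn (j : ℕ) (E : Finset α) (D : Finset (Finset α)) : Finset (Finset α) :=
  E.powersetCard j \ D

/-- The `(j+1)`-subsets of `E` above a member of `𝒜`. -/
def upNbhdIn (j : ℕ) (E : Finset α) (𝒜 : Finset (Finset α)) : Finset (Finset α) :=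
  (E.powersetCard (j + 1)).filter (fun Y => ∃ X ∈ 𝒜, X ⊆ Y)

/-- **(SP) inside `E`** for one code: `#𝒜 · C(#E, j+1) ≤ #N_E(𝒜) · #P_E` for every `𝒜 ⊆ P_E`. -/
def PuncturedNMPIn (j : ℕ) (E : Finset α) (D : Finset (Finset α)) : Prop :=
  ∀ 𝒜 ⊆ puncturedIn j E D, 𝒜.card * E.card.choose (j + 1) ≤ (upNbhdIn j E 𝒜).card * (puncturedIn j E D).card

/-! ### The subtype dictionary -/

/-- The restriction of a finset to the subtype of `E`. -/
def toSub (E : Finset α) (X : Finset α) : Finset {x // x ∈ E} := X.subtype (fun x => x ∈ E)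

/-- The embedding of the subtype back into `α`. -/
def ofSub (E : Finset α) (X : Finset {x // x ∈ E}) : Finset α := X.map (Function.Embedding.subtype (fun x => x ∈ E))

/-- Membership in the restriction. -/
theorem mem_toSub {E X : Finset α} {a : {x // x ∈ E}} : a ∈ toSub E X ↔ (a : α) ∈ X := by
  unfold toSub
  rw [mem_subtype]

omit [DecidableEq α] in
/-- Membership in the embedded image. -/
theorem mem_ofSub {E : Finset α} {X : Finset {x // x ∈ E}} {a : α} : a ∈ ofSub E X ↔ ∃ h : a ∈ E, ⟨a, h⟩ ∈ X := by
  unfold ofSub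
  rw [mem_map]
  constructor
  · rintro ⟨⟨b, hb⟩, hbX, rfl⟩
    exact ⟨hb, hbX⟩
  · rintro ⟨h, hX⟩
    exact ⟨⟨a, h⟩, hX, rfl⟩

/-- `ofSub ∘ toSub` is the identity on the subsets of `E`. -/
theorem ofSub_toSub {E X : Finset α} (hX : X ⊆ E) : ofSub E (toSub E X) = X := by
  ext a
  rw [mem_ofSub]
  constructor
  · rintro ⟨h, hX'⟩
    exact mem_toSub.1 hX'
  · intro ha
    exact ⟨hX ha, mem_toSub.2 ha⟩

/-- `toSub ∘ ofSub` is the identity. -/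
theorem toSub_ofSub {E : Finset α} (X : Finset {x // x ∈ E}) : toSub E (ofSub E X) = X := by
  ext ⟨a, ha⟩
  rw [mem_toSub, mem_ofSub]
  constructor
  · rintro ⟨h, hX⟩
    exact hX
  · intro hX
    exact ⟨ha, hX⟩

omit [DecidableEq α] in
/-- The embedded image lies in `E`. -/
theorem ofSub_subset (E : Finset α) (X : Finset {x // x ∈ E}) : ofSub E X ⊆ E := by
  intro a ha
  obtain ⟨h, -⟩ := mem_ofSub.1 ha
  exact h

omit [DecidableEq α] in
/-- `ofSub` preserves cardinality. -/
theorem card_ofSub (E : Finset α) (X : Finset {x // x ∈ E}) : (ofSub E X).card = X.card := by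
  unfold ofSub
  rw [card_map]

/-- `toSub` preserves the cardinality of the subsets of `E`. -/
theorem card_toSub {E X : Finset α} (hX : X ⊆ E) : (toSub E X).card = X.card := by
  rw [← card_ofSub E (toSub E X), ofSub_toSub hX]

/-- `toSub` commutes with intersections. -/
theorem toSub_inter (E X Y : Finset α) : toSub E (X ∩ Y) = toSub E X ∩ toSub E Y := by
  ext a
  simp only [mem_toSub, mem_inter]

/-- `toSub` is monotone. -/
theorem toSub_subset_toSub {E X Y : Finset α} (h : X ⊆ Y) : toSub E X ⊆ toSub E Y := by
  intro a ha
  rw [mem_toSub] at ha ⊢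
  exact h ha

omit [DecidableEq α] in
/-- `ofSub` is monotone. -/
theorem ofSub_subset_ofSub {E : Finset α} {X Y : Finset {x // x ∈ E}} (h : X ⊆ Y) : ofSub E X ⊆ ofSub E Y := by
  intro a ha
  rw [mem_ofSub] at ha ⊢
  obtain ⟨h1, h2⟩ := ha
  exact ⟨h1, h h2⟩

/-- `toSub` is injective on the subsets of `E`. -/
theorem toSub_injOn (E : Finset α) : Set.InjOn (toSub E) (E.powerset : Set (Finset α)) := by
  intro X hX Y hY h
  rw [mem_coe, mem_powerset] at hX hY
  rw [← ofSub_toSub hX, ← ofSub_toSub hY, h]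

/-- The subsets of `E` of size `k` correspond to the `k`-subsets of the subtype. -/
theorem image_toSub_powersetCard (E : Finset α) (k : ℕ) :
    (E.powersetCard k).image (toSub E) = (univ : Finset {x // x ∈ E}).powersetCard k := by
  ext X'
  simp only [mem_image, mem_powersetCard, subset_univ, true_and]
  constructor
  · rintro ⟨X, ⟨hXE, hXc⟩, rfl⟩
    rw [card_toSub hXE, hXc]
  · intro hc
    exact ⟨ofSub E X', ⟨ofSub_subset E X', by rw [card_ofSub, hc]⟩, toSub_ofSub X'⟩

/-! ### The transfer -/

/-- The image of a code in `E` is a code on the subtype. -/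
theorem isCode_image_toSub {j : ℕ} {E : Finset α} {D : Finset (Finset α)} (hD : IsCodeIn j E D) :
    IsCode j (D.image (toSub E)) := by
  refine ⟨?_, ?_⟩
  · intro B' hB'
    obtain ⟨B, hB, rfl⟩ := mem_image.1 hB'
    rw [card_toSub (hD.1 B hB).1, (hD.1 B hB).2]
  · intro B₁' hB₁' B₂' hB₂' hne
    obtain ⟨B₁, hB₁, rfl⟩ := mem_image.1 hB₁'
    obtain ⟨B₂, hB₂, rfl⟩ := mem_image.1 hB₂'
    have hne' : B₁ ≠ B₂ := fun h => hne (h ▸ rfl)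
    rw [← toSub_inter, card_toSub (inter_subset_left.trans (hD.1 B₁ hB₁).1)]
    exact hD.2 B₁ hB₁ B₂ hB₂ hne'

/-- The punctured level inside `E` maps onto the punctured level of the image code. -/
theorem image_toSub_puncturedIn {j : ℕ} {E : Finset α} {D : Finset (Finset α)} (hD : IsCodeIn j E D) :
    (puncturedIn j E D).image (toSub E) = punctured j (D.image (toSub E)) := by
  ext X'
  simp only [mem_image, puncturedIn, mem_sdiff, mem_powersetCard, mem_punctured]
  constructor
  · rintro ⟨X, ⟨⟨hXE, hXc⟩, hXD⟩, rfl⟩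
    refine ⟨by rw [card_toSub hXE, hXc], ?_⟩
    rintro ⟨B, hB, hBX⟩
    apply hXD
    have : B = X := by
      rw [← ofSub_toSub (hD.1 B hB).1, ← ofSub_toSub hXE, hBX]
    exact this ▸ hB
  · rintro ⟨hc, hX'D⟩
    refine ⟨ofSub E X', ⟨⟨ofSub_subset E X', by rw [card_ofSub, hc]⟩, ?_⟩, toSub_ofSub X'⟩
    intro hX
    exact hX'D ⟨ofSub E X', hX, toSub_ofSub X'⟩

/-- The up-shadow inside `E` maps onto the up-shadow of the image family. -/
theorem image_toSub_upNbhdIn {j : ℕ} {E : Finset α} {𝒜 : Finset (Finset α)} (h𝒜 : ∀ X ∈ 𝒜, X ⊆ E) :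
    (upNbhdIn j E 𝒜).image (toSub E) = upNbhd j (𝒜.image (toSub E)) := by
  ext Y'
  simp only [mem_image, upNbhdIn, mem_filter, mem_powersetCard, mem_upNbhd]
  constructor
  · rintro ⟨Y, ⟨⟨hYE, hYc⟩, X, hX, hXY⟩, rfl⟩
    exact ⟨by rw [card_toSub hYE, hYc], toSub E X, ⟨X, hX, rfl⟩, toSub_subset_toSub hXY⟩
  · rintro ⟨hc, X', ⟨X, hX, rfl⟩, hXY'⟩
    refine ⟨ofSub E Y', ⟨⟨ofSub_subset E Y', by rw [card_ofSub, hc]⟩, X, hX, ?_⟩, toSub_ofSub Y'⟩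
    rw [← ofSub_toSub (h𝒜 X hX)]
    exact ofSub_subset_ofSub hXY'

/-- **(SP) inside `E` from (SP) for the image code on the subtype.** -/
theorem puncturedNMP_in_of_subtype {j : ℕ} {E : Finset α} {D : Finset (Finset α)} (hD : IsCodeIn j E D)
    (h : PuncturedNMP j (D.image (toSub E))) : PuncturedNMPIn j E D := by
  intro 𝒜 h𝒜
  have h𝒜E : ∀ X ∈ 𝒜, X ⊆ E := fun X hX => (mem_powersetCard.1 (mem_sdiff.1 (h𝒜 hX)).1).1
  have hPE : ∀ X ∈ puncturedIn j E D, X ⊆ E := fun X hX => (mem_powersetCard.1 (mem_sdiff.1 hX).1).1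
  have hNE : ∀ Y ∈ upNbhdIn j E 𝒜, Y ⊆ E := fun Y hY => (mem_powersetCard.1 (mem_filter.1 hY).1).1
  have hinj : ∀ (S : Finset (Finset α)), (∀ X ∈ S, X ⊆ E) → (S.image (toSub E)).card = S.card := by
    intro S hS
    apply card_image_of_injOn
    intro X hX Y hY hXY
    exact toSub_injOn E (by rw [mem_coe, mem_powerset]; exact hS X hX) (by rw [mem_coe, mem_powerset]; exact hS Y hY) hXY
  have hsub : 𝒜.image (toSub E) ⊆ punctured j (D.image (toSub E)) := by
    rw [← image_toSub_puncturedIn hD]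
    exact image_subset_image h𝒜
  have key := h (𝒜.image (toSub E)) hsub
  rw [hinj 𝒜 h𝒜E, ← image_toSub_upNbhdIn h𝒜E, ← image_toSub_puncturedIn hD, hinj _ hNE, hinj _ hPE] at key
  have hY : (levelAbove {x // x ∈ E} j).card = E.card.choose (j + 1) := by
    rw [card_levelAbove_eq, Fintype.card_coe]
  rw [hY] at key
  exact key

/-- **THEOREM A INSIDE `E`**: (SP) holds for every code of `j`-subsets of `E` with `1 ≤ j`, `2j + 1 ≤ #E`, `3j ≤ #E + 1`. -/
theorem puncturedNMP_in_of_three_j {j : ℕ} {E : Finset α} {D : Finset (Finset α)} (hD : IsCodeIn j E D)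
    (hj : 1 ≤ j) (hn : 2 * j + 1 ≤ E.card) (h3 : 3 * j ≤ E.card + 1) : PuncturedNMPIn j E D := by
  apply puncturedNMP_in_of_subtype hD
  apply puncturedNMP_of_three_j (isCode_image_toSub hD) hj
  · rw [Fintype.card_coe]
    exact hn
  · rw [Fintype.card_coe]
    exact h3

end PercRepro.PuncturedLYM
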